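import Literature.NumberTheory.EllipticCurves.ZpExtensionEisensteinLocalKernelLiftableProofs
import Literature.NumberTheory.EllipticCurves.ZpExtensionEisensteinDVRSettingH4TowerPairingProofs
import HarnessLib

/-!
# (Ker) for the curve's Eisenstein tower in the `D`-indexed currency of the H.4 descent (theorems only)

`Proofs` file (theorems only; no definition, no named fact, no instance, no `sorry`).  Topic `NumberTheory/EllipticCurves`
(D1 road of cell `pub/bsd-print-x9`, LEAD `bsd-line-x10b-p1` g8, (H4-KER) curve instance; companion of
`ZpExtensionEisensteinLocalKernelLiftableProofs` (p661791) and of x9-p1-w2's `ZpExtensionEisensteinDVRSettingH4TowerPairingProofs`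
(p660339, the `D`-indexed towers `X_j := H¹(K_v, T^{(j)})`, `T^{(j)} = E_K[p^{j+1}] ⊗ A_{m,j+1}(ψ)` with the reductions of
`DVRSetting.cond_red`)).

* §1 `Tower.ker_map_le_levelCondition_bot_of_le` — the free-index form of `Tower.ker_map_up_le_levelCondition_bot`
  (`f a b` for `a ≤ b` instead of `f k (k + d)`).
* §2 **`WeierstrassCurve.eisensteinTower_ker_map_transfer_le_levelCondition_bot`** — for `T := W.eisensteinTower κ hm`, a finite
  place `v` and `k d : ℕ`: the kernel of `up_d := H¹(K_v, ×p^d : T^{(k)} ↪ T^{(k+d)})` — spelled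
  `galoisCohomology.map (localMap (E_K.eisensteinTwistTorsionTransfer κ hm t _ (k+1) (k+d+1)) (Sum.inr v)) 1`, the `up` of
  x9-p1-w2 g8's (H4-ADJ-INST) — lies in the BOTTOM level condition `Tower.levelCondition red_D p ⊥ k` of the `D`-indexed tower:
  VERBATIM the binder `hKer` of `Tower.mem_levelCondition_top_of_forall_pairing_bot_eq_zero_of_range` (x9-p1-w4 g5, p659369) in the
  (H4-INST)/(H4-PERF-INST) currency.  Proof: the F_𝔮-currency lemma at level `k+1` + the index shift
  `levelCondition_eisensteinLocalReduce_succ`.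
No summit statement is proved; BSD is not proved by any of this.

References: B. Howard, Compositio Math. 140 (2004), Def. 1.1.3, §1.3 H.4, §2.2, Def. 3.2.6 (arXiv:1202.6340 p. 5, p. 7 L69–82,
p. 16); J.-P. Serre, *Galois Cohomology* (1997), I §2.2.
-/

set_option autoImplicit false

noncomputable section

open Function NumberField IsDedekindDomain Field CategoryTheory
open scoped NumberField ContRepresentation TensorProduct Classical

/-! ## §1 Free-index form of the generic (Ker) lemma -/

namespace Literature.NumberTheory.EllipticCurves.Tower

open Literature.NumberTheory.GaloisRepresentations

universe u

variable {F : Type u} [Field F]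
variable {W : ℕ → Type u} [∀ j, AddCommGroup (W j)] [∀ j, TopologicalSpace (W j)] [∀ j, DiscreteTopology (W j)]
variable (ρ : ∀ j, DiscreteGaloisModule F (W j))
variable (f : ∀ a b, (ρ a).toContRepresentation →ⁱL (ρ b).toContRepresentation)

/-- **(Ker), free indices**: for `a ≤ b`, `ker H¹(f a b) ≤ levelCondition red p ⊥ a`.
[cite: Howard2004HeegnerKolyvagin, §1.3 H.4 (arXiv p. 7 L78–82)] [cite: SerreGaloisCohomology1997, Ch. I §2.2] -/
theorem ker_map_le_levelCondition_bot_of_le (hid : ∀ a (w : W a), f a a w = w)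
    (hcomp : ∀ a b c, c ≤ b → b ≤ a → ∀ w : W a, f b c (f a b w) = f a c w)
    (hsq : ∀ a b, a ≤ b → ∀ w : W (a + 1), f a b (f (a + 1) a w) = f (b + 1) b (f (a + 1) (b + 1) w))
    (hinj : ∀ ℓ n, Function.Injective (f ℓ (ℓ + n)))
    (hsurj : ∀ ℓ n, Function.Surjective (f (ℓ + n) n))
    (hex : ∀ ℓ n (y : W (ℓ + n)), f (ℓ + n) n y = 0 ↔ ∃ x, f ℓ (ℓ + n) x = y)
    (p : ℕ) (hkill : ∀ j (w : W j), p ^ j • w = 0) {a b : ℕ} (hab : a ≤ b) :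
    (galoisCohomology.map (f a b) 1).ker ≤
      levelCondition (H := fun j ↦ galoisCohomology (ρ j) 1) (fun j ↦ galoisCohomology.map (f (j + 1) j) 1) p
        (fun j ↦ (⊥ : AddSubgroup (galoisCohomology (ρ j) 1))) a := by
  obtain ⟨d, rfl⟩ := Nat.exists_eq_add_of_le hab
  exact ker_map_up_le_levelCondition_bot ρ f hid hcomp hsq hinj hsurj hex p hkill a d

end Literature.NumberTheory.EllipticCurves.Tower

/-! ## §2 The curve's Eisenstein tower, `D`-indexed -/

namespace WeierstrassCurve

open Literature.NumberTheory.EllipticCurves Literature.NumberTheory.GaloisRepresentations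
open Literature.NumberTheory.GaloisRepresentations.DiscreteGaloisModule
open Literature.NumberTheory.GaloisCohomology.Howard2004
open Literature.NumberTheory.EllipticCurves.ZpExtension (EisensteinLevel)

variable {K : Type} [Field K] [NumberField K] (W : WeierstrassCurve ℚ) [W.IsElliptic] {p : ℕ} [hp : Fact p.Prime]
  (κ : ZpExtension K p) {m : ℕ} (hm : 1 ≤ m)

/-- **(Ker) for the curve's local Eisenstein tower, F_𝔮 currency, free indices**: for `a ≤ b` the kernel of
`H¹(K_v, ×p^{b-a} : W_a ↪ W_b)` (`W_j = E_K[p^j] ⊗ A_{m,j}(ψ)`, the map `eisensteinTwistTorsionTransfer … a b`) lies in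
`Tower.levelCondition (eisensteinLocalReduce …) p ⊥ a`. [cite: Howard2004HeegnerKolyvagin, §1.3 H.4 and §2.2 (arXiv p. 7 L78–82)] -/
theorem ker_map_eisensteinTwistTorsionTransfer_le_levelCondition_bot (v : HeightOneSpectrum (𝓞 K)) {a b : ℕ}
    (hab : a ≤ b) :
    (galoisCohomology.map (DiscreteGaloisModule.localMap
        ((W.baseChange K).eisensteinTwistTorsionTransfer κ hm (fun j ↦ (W.baseChange K).torsionGaloisModuleReduce p j)
          (fun _ _ ↦ rfl) a b) (Sum.inr v)) 1).ker ≤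
      Tower.levelCondition (κ.eisensteinLocalReduce (fun j ↦ (W.baseChange K).torsionGaloisModule ((p : ℤ) ^ j))
          (fun j ↦ (W.baseChange K).torsionGaloisModuleReduce p j) hm (Sum.inr v)) p
        (fun j ↦ (⊥ : AddSubgroup (galoisCohomology
          ((κ.eisensteinTwist ((W.baseChange K).torsionGaloisModule ((p : ℤ) ^ j)) hm j).toLocal (Sum.inr v)) 1))) a := by
  obtain ⟨d, rfl⟩ := Nat.exists_eq_add_of_le hab
  have hpK : (p : K) ≠ 0 := Nat.cast_ne_zero.2 hp.out.ne_zero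
  exact κ.ker_map_eisensteinTwistTransfer_le_levelCondition_bot (fun j ↦ (W.baseChange K).torsionGaloisModule ((p : ℤ) ^ j))
    (fun j ↦ (W.baseChange K).torsionGaloisModuleReduce p j) hm _ _ _
    (fun k ↦ ((W.baseChange K).nonempty_geomTorsion_prime_pow_addEquiv_fin_two hpK k).some) v a d

/-- **(Ker) in the `D`-indexed currency of the H.4 descent.**  For `T := W.eisensteinTower κ hm` (`T^{(j)} =
E_K[p^{j+1}] ⊗ A_{m,j+1}(ψ)`), a finite place `v` and `k d : ℕ`, the kernel of
`up_d := H¹(K_v, ×p^d : T^{(k)} ↪ T^{(k+d)})` lies in the bottom level condition of the tower `j ↦ H¹(K_v, T^{(j)})` with the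
reductions `H¹(T.red j)` — the binder `hKer` of `Tower.mem_levelCondition_top_of_forall_pairing_bot_eq_zero_of_range`.
[cite: Howard2004HeegnerKolyvagin, §1.3 H.4 and Def. 3.2.6 (arXiv p. 7 L78–82, p. 16)] [cite: SerreGaloisCohomology1997, Ch. I §2.2] -/
theorem eisensteinTower_ker_map_transfer_le_levelCondition_bot (v : HeightOneSpectrum (𝓞 K)) (k d : ℕ) :
    letI := IwasawaAlgebra.isLocalRing_quotient_X_pow_add_C p hm
    (galoisCohomology.map (DiscreteGaloisModule.localMap
        ((W.baseChange K).eisensteinTwistTorsionTransfer κ hm (fun j ↦ (W.baseChange K).torsionGaloisModuleReduce p j)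
          (fun _ _ ↦ rfl) (k + 1) (k + d + 1)) (Sum.inr v)) 1).ker ≤
      Tower.levelCondition (H := fun j ↦ galoisCohomology (((W.eisensteinTower κ hm).ρ j).toLocal (Sum.inr v)) 1)
        (fun j ↦ ContinuousRep.cohomologyMap (((W.eisensteinTower κ hm).ρ (j + 1)).toLocal (Sum.inr v))
          (((W.eisensteinTower κ hm).ρ j).toLocal (Sum.inr v)) ((W.eisensteinTower κ hm).red j).toAddMonoidHom
          continuous_of_discreteTopology (fun _ z => (W.eisensteinTower κ hm).red_equivariant j _ z) 1)
        p (fun j ↦ (⊥ : AddSubgroup (galoisCohomology (((W.eisensteinTower κ hm).ρ j).toLocal (Sum.inr v)) 1))) k := by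
  letI := IwasawaAlgebra.isLocalRing_quotient_X_pow_add_C p hm
  exact (W.ker_map_eisensteinTwistTorsionTransfer_le_levelCondition_bot κ hm v
    (show k + 1 ≤ k + d + 1 by omega)).trans
    (le_of_eq (W.levelCondition_eisensteinLocalReduce_succ κ hm (Sum.inr v) (fun j ↦ ⊥) k))

end WeierstrassCurve

end
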